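import Literature.AnabelianGeometry.EtaleTheta.TowerOfSetting
import Literature.AnabelianGeometry.EtaleTheta.Discharge.Sec2OddBijectivityProofs
import Literature.AnabelianGeometry.EtaleTheta.Discharge.Sec2NondiscretenessProofs

/-!
# [EtTh] §2 over §1: Cor 2.16 and the last clause of Cor 2.18 (iv) for the MODEL tower of `X̲̲`
# (merge pass: the binder `Π^tp_Ÿ ↠ G_K` discharged by the §1 setting)

Mochizuki, *The Étale Theta Function and its Frobenioid-theoretic Manifestations* [EtTh],
Publ. RIMS 45 (2009), §2, Cor 2.16 p.53, Cor 2.18 (iv) p.62 (locators `p.N` = PDF pages of the PRIMS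
text; bib key `MochizukiEtTh2009`). PROOF-ONLY companion (no `def`; seat abc-iut-L2-t2) of
`TowerOfSetting.lean` (seat abc-iut-L2-t8: the interface `ThetaEnvTower` INSTANTIATED from the §1 theta
setting as `DoubleUnderline.thetaEnvTower`) and of this seat's conditional discharges
`Discharge/Sec2OddBijectivityProofs.lean`, `Discharge/Sec2NondiscretenessProofs.lean`: their common
binder "`Π^tp_Ÿ̲̲ ↠ G_K`" (`K = K̈`, p.39/p.41 — the `RigidData` axiom `augYdd_surjective`, not a field of
the tower) HOLDS for the model (`DoubleUnderline.map_aug_Ydduu`, seat abc-iut-L2-t8), so for the model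
tower Cor 2.16 is conditional ONLY on the bi-theta symmetry clause of Prop 2.14 (iii) (`hshift`), and the
odd-bijectivity clause of Cor 2.18 (iv) ONLY on Cor 2.18 (iii) and the first half of Cor 2.18 (iv) — the
printed dependencies. HONEST FRAMING: no side is taken on [IUTchIII] Cor 3.12; typed ≠ discharged
elsewhere.
-/

noncomputable section

namespace Literature.AnabelianGeometry.EtaleTheta

open Literature.AnabelianGeometry.SemiGraphs

namespace ThetaSetting.EtaleThetaData.DoubleUnderline

variable {p : ℕ} [Fact p.Prime] {D : ThetaSetting p} {E : D.EtaleThetaData} {l : ℕ}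
  (C : E.DoubleUnderline l) {Es : Set ℕ+} (τ : D.CyclotomeTower l Es)

/-- **`Π^tp_Ÿ̲̲ ↠ G_K` for the model tower** (every element of `G_K` lifts to `Π^tp_Ÿ ∩ Π^tp_X̲̲`;
`DoubleUnderline.map_aug_Ydduu`). [cite: MochizukiEtTh2009, Prop 2.2(iii) p.37] -/
theorem thetaEnvTower_augYdd_surjective (hC : D.Compat) (hS : D.Sec2Hyps) :
    Function.Surjective
      ((C.thetaEnvTower τ hC hS).aug.comp (C.thetaEnvTower τ hC hS).PiYdd.subtype) := by
  intro γ
  have h : (γ : GQp p) ∈ (D.GtpYdd ⊓ C.Huu).map D.aug.toMonoidHom := by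
    rw [C.map_aug_Ydduu]; exact γ.2
  obtain ⟨k, hk, hkγ⟩ := h
  exact ⟨⟨⟨k, (Subgroup.mem_inf.1 hk).2⟩, (Subgroup.mem_inf.1 hk).1⟩, Subtype.ext hkγ⟩

/-- **Corollary 2.16 for the model tower of `X̲̲`** — conditional only on the bi-theta symmetry clause
of Prop 2.14 (iii) in cocycle form (`hshift`: the conjugate of a mod-`M` theta cocycle by `x ∈ Π^tp_X̲̲`
with `M ∣ [x̄] ∈ Gal(Y/X̲̲) ≅ ℤ` differs from it by a coboundary).
[cite: MochizukiEtTh2009, Cor 2.16 p.53] -/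
theorem cor216_of_model (hC : D.Compat) (hS : D.Sec2Hyps)
    (hshift : ∀ (M : Es) (η : (C.thetaEnvTower τ hC hS).PiYdd → (C.thetaEnvTower τ hC hS).mu M),
      η ∈ (C.thetaEnvTower τ hC hS).thetaCocycles M → ∀ x : (C.thetaEnvTower τ hC hS).PiX,
      ((M : ℕ+) : ℤ) ∣ Multiplicative.toAdd
          ((C.thetaEnvTower τ hC hS).galYX (QuotientGroup.mk x)) →
      ∃ c : (C.thetaEnvTower τ hC hS).mu M, (C.thetaEnvTower τ hC hS).conjCocycle M x η =
        η * CycEnvelope.coboundary ((C.thetaEnvTower τ hC hS).aug.comp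
          (C.thetaEnvTower τ hC hS).PiYdd.subtype) ((C.thetaEnvTower τ hC hS).chi M) c) :
    (C.thetaEnvTower τ hC hS).Cor216 :=
  (C.thetaEnvTower τ hC hS).cor216_of (C.thetaEnvTower_augYdd_surjective τ hC hS) hshift

/-- **Corollary 2.18 (iv), "[hence a bijection if `N/M` is odd]", for the model tower of `X̲̲`** —
conditional only on the level-wise named facts of Cor 2.18 (iii) (`Cor218_iii_PiX`,
`Cor218_iii_quotient`) and of the first half of Cor 2.18 (iv) (`Cor218_iv_surjective`,
`Cor218_iv_fibre`, `Cor218_iv_reduction`). [cite: MochizukiEtTh2009, Cor 2.18(iv) p.62] -/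
theorem cor218_iv_bijective_of_odd_of_model (hC : D.Compat) (hS : D.Sec2Hyps)
    (hP : ∀ M : Es, ((C.thetaEnvTower τ hC hS).level M).Cor218_iii_PiX)
    (hq : ∀ M : Es, ((C.thetaEnvTower τ hC hS).level M).Cor218_iii_quotient)
    (hlift : ∀ M : Es, ((C.thetaEnvTower τ hC hS).level M).Cor218_iv_surjective)
    (hfib : ∀ M : Es, ((C.thetaEnvTower τ hC hS).level M).Cor218_iv_fibre)
    (hred : (C.thetaEnvTower τ hC hS).Cor218_iv_reduction) :
    (C.thetaEnvTower τ hC hS).Cor218_iv_bijective_of_odd :=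
  (C.thetaEnvTower τ hC hS).cor218_iv_bijective_of_odd_of_levels hP hq hlift hfib hred
    (C.thetaEnvTower_augYdd_surjective τ hC hS)

/-- The same, with both Cor 2.18 (iii) inputs replaced by temp-slimness of `Π^tp_X̲̲` ([SemiAnbd]
Ex. 3.10). [cite: MochizukiEtTh2009, Cor 2.18(iv) p.62] -/
theorem cor218_iv_bijective_of_odd_of_model_tempSlim (hC : D.Compat) (hS : D.Sec2Hyps)
    (hts : ∀ U : Subgroup C.Huu, IsOpen (U : Set C.Huu) →
      ∀ z : C.Huu, (∀ u ∈ U, z * u = u * z) → z = 1)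
    (hlift : ∀ M : Es, ((C.thetaEnvTower τ hC hS).level M).Cor218_iv_surjective)
    (hfib : ∀ M : Es, ((C.thetaEnvTower τ hC hS).level M).Cor218_iv_fibre)
    (hred : (C.thetaEnvTower τ hC hS).Cor218_iv_reduction) :
    (C.thetaEnvTower τ hC hS).Cor218_iv_bijective_of_odd :=
  (C.thetaEnvTower τ hC hS).cor218_iv_bijective_of_odd_of_tempSlim hts hlift hfib hred
    (C.thetaEnvTower_augYdd_surjective τ hC hS)

end ThetaSetting.EtaleThetaData.DoubleUnderline

end Literature.AnabelianGeometry.EtaleTheta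

end
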